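import Summits.AtomisticToContinuum.HydrodynamicLimit.Theses.ImplosionDichotomy
import Summits.AtomisticToContinuum.HydrodynamicLimit.Theses.LaxScheme
import Summits.AtomisticToContinuum.HydrodynamicLimit.Theses.OneFlightGossipEngine
import Summits.AtomisticToContinuum.HydrodynamicLimit.Theorems.ImplosionDichotomyHydroLimitInBandEntropyDock
import Summits.AtomisticToContinuum.HydrodynamicLimit.Theorems.ImplosionDichotomyHydroLimitInBandCoreReduction
import Summits.AtomisticToContinuum.HydrodynamicLimit.Theorems.ImplosionDichotomyHydroLimitInBandReferenceIdentification
import Summits.AtomisticToContinuum.HydrodynamicLimit.Theorems.ImplosionDichotomyHydroLimitInBandLedgerApriori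
import Summits.AtomisticToContinuum.HydrodynamicLimit.Theorems.TwoClocksClampedEntropyClockTimeZeroReference
import Summits.AtomisticToContinuum.HydrodynamicLimit.Theorems.OneFlightGossipEngineUniformLocalGibbsConcentration
import Summits.AtomisticToContinuum.HydrodynamicLimit.Theorems.OneFlightGossipEngineClampedCurrentsDockLedgerGlue
import Summits.AtomisticToContinuum.HydrodynamicLimit.Theorems.OneFlightGossipEngineClampedCurrentsDockFromWindows
import Summits.AtomisticToContinuum.HydrodynamicLimit.Theorems.OneFlightGossipEngineClampedCurrentsDockPathwise
import Summits.AtomisticToContinuum.HydrodynamicLimit.Theorems.OneFlightGossipEngineClampedCurrentsDockCancellation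
import Summits.AtomisticToContinuum.HydrodynamicLimit.Theorems.OneFlightGossipEngineClampedCurrentsDockEos
import Summits.AtomisticToContinuum.HydrodynamicLimit.Theorems.OneFlightGossipEngineClampedCurrentsDockClampRemainder
import Literature.MathematicalPhysics.KineticTheory.HardSphereEulerLLN
import Literature.MathematicalPhysics.KineticTheory.HardSphereEulerProofs
import HarnessLib

/-!
# `HydroLimitInBand` from the shared one-window heart, the window continuity and the inputs (line `IdeatorOneSketch`, crux stmt-9133)

Support file (`--supports stmt-AtomisticToContinuum-9133`) recording IN THE TREE the kernel-checked composition of the registered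
skeleton `Cruxes/HydroLimitInBand/Lines/IdeatorOneSketch.lean` (v9): the packing-guarded hydrodynamic limit
`Summit.AtomisticToContinuum.HydrodynamicLimit.Theses.ImplosionDichotomy.HydroLimitInBand` (= `Theses.LaxScheme.HydroLimitInBand`)
follows from
* the SHARED HEART `OneWindowLedger` (registered as `stub_oneWindowLedgerInBand` on stmt-9133 and `stub_oneWindowLedger` on the sibling crux
  stmt-14680, same term: the four landed pathwise/pointwise pieces S2/S8/S4/S10 and the six inputs imply the one-window entropy ledger
  with static term `ClampedCurrentsDockFromWindows.OneWindowLedgerStatic`),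
* the window continuity `WindowContinuity := CollisionActivityTails → CollisionEnergyActivityTails → EnergyCurrentTails →
  WindowContinuityInBand` (LANDED, p118327, `HydroLimitInBandContinuity.stub_windowContinuityInBand`; kept as a hypothesis here only until
  the farm has built its module — then `hydroLimitInBand_of_heart_of_inputs` below discharges it), and
* the inputs `LineInputs` (the local clamped collisional-transfer window LD along families, the energy-activity tails, the weighted
  coherence input, KCWU along families, CAT 13734, ECT 9235 — conjecture-grade, for the planner to file),
everything else being landed: dock p97115, reduction p97252, reference identification p107756, a-priori bound p109679, the sibling's
summation p117552, time zero (15145), running-supremum Grönwall (14680), the analytic insertion factor and the uniform local Gibbs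
concentration. Lead prover-line-stmt-AtomisticToContinuum-9133-c2-0, cycle 3.
-/

noncomputable section

open MeasureTheory Filter Set Topology InformationTheory
open scoped ENNReal

namespace Summit.AtomisticToContinuum.HydrodynamicLimit.Theorems.HydroLimitInBandOfHeart

open Literature.MathematicalPhysics.KineticTheory Literature.Analysis.FluidPDE Literature.Analysis.FunctionSpaces
open Summit.AtomisticToContinuum.HydrodynamicLimit.Theses
open Summit.AtomisticToContinuum.HydrodynamicLimit.Theorems (stub_eosRatioAnalytic uniformLocalGibbsConcentration_proof)
open Summit.AtomisticToContinuum.HydrodynamicLimit.Theorems.PolynomialCompressionStatics (integral_rhoLim_eq_one)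
open Summit.AtomisticToContinuum.HydrodynamicLimit.Theorems.ClampedCurrentsDockPathwise (PathwiseEntropyProduction)
open Summit.AtomisticToContinuum.HydrodynamicLimit.Theorems.ClampedCurrentsDockCancellation (EulerCancellation)
open Summit.AtomisticToContinuum.HydrodynamicLimit.Theorems.ClampedCurrentsDockEos (EosConsistency)
open Summit.AtomisticToContinuum.HydrodynamicLimit.Theorems.ClampedCurrentsDockClampRemainder (TransferClampRemainder)
open Summit.AtomisticToContinuum.HydrodynamicLimit.Theorems.ClampedCurrentsDockFromWindows
  (LedgerAprioriBound LedgerIntegratedCoreInBand WindowContinuityInBand OneWindowLedgerStatic LedgerFromWindowsS stub_ledgerFromWindowsS)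

/-! ## §1 The intermediate statements (verbatim from the skeleton) -/

/-- **The GUARDED GRONWALL CORE** (Yau's relative-entropy estimate along a handed-over reference, in band): verbatim the
hypothesis `gronwall` of the landed `EntropyClockDock.clampedWindowDock_of_gronwall` (13735) with `DiluteSelfConsistency`
replaced by the guard `ρ_t(x)σ³ < η_c` on `[0,T) × 𝕋³`. -/
def GronwallCoreInBand : Prop :=
  ∃ ηc : ℝ, 0 < ηc ∧ ∀ (a₀ θ₀ : T3 → ℝ) (u₀ : T3 → V3), Continuous a₀ → Continuous θ₀ → Continuous u₀ →
    (∀ x, 0 < a₀ x) → (∀ x, 0 < θ₀ x) → ∃ σ₀ : ℝ, 0 < σ₀ ∧ ∀ σ : ℝ, 0 < σ → σ < σ₀ →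
    ∀ (T : ℝ) (ρ θ : ℝ → T3 → ℝ) (u : ℝ → T3 → V3), IsHardSphereEulerSolution σ T ρ u θ →
    (∀ t ∈ Set.Ico 0 T, ∀ x, ρ t x * σ ^ 3 < ηc) →
    ∀ Φ : (N : ℕ) → HardSphereFlow (Torus.geometry (Fin 3)) (hsDiameter σ N) (N + 1),
    TendstoHydroFieldsAt (fun N => localGibbsLaw σ a₀ u₀ θ₀ N (Φ N)) Φ ρ u θ 0 →
    ∀ t ∈ Set.Ioo 0 T, ∀ (a : T3 → ℝ) (hac : Continuous a) (hap : ∀ x, 0 < a x),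
      (∀ x, ρ t x ≤ a x ∧ a x ≤ 2 * ρ t x) → SmallDensity (profileOf a hac hap) σ →
      rhoLim (profileOf a hac hap) σ = ρ t →
      Tendsto (fun N : ℕ => klDiv ((Φ N).lawAt (localGibbsLaw σ a₀ u₀ θ₀ N (Φ N)) t)
        (localGibbsLaw σ a (u t) (θ t) N (Φ N)) / ((N : ℝ≥0∞) + 1)) atTop (𝓝 0)

/-! ## §2 The inputs (verbatim from the skeleton; byte-identical in the sibling crux 14680's skeleton) -/

/-- **KCWU ALONG FAMILIES = `KineticCurrentsWindowLDFamily`** (v8; the family-uniform typing of the board item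
`OneFlightGossipEngine.KineticCurrentsWindowLDUniform`, stmt-14662, that an entropy clock along a time-dependent reference can
consume). Same `η₀`-uniform packing guard, same class of fast kinetic currents `F = Σ A_jk w_j w_k + (b·w) G(x,|w|²)`,
`F ⊥ 1, v, |v|²` under the local Maxwellian, same scale-`N` exponential-moment bound over the kinetic window
`w_N = τ (N+1)^{-1/3}` — but the data are one-parameter FAMILIES `s ↦ (a_s, θ_s, u_s; A_s, b_s, G_s)`, jointly continuous in
`(s, ·)`, the hypotheses are asked for every `s ∈ [0, t₁]`, and the thresholds `β₀, τ₀, N₀` are uniform: `∀ s ∈ [0,t₁]` is the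
INNERMOST quantifier (as in the true-law inputs CAT / ECT). Window quantifier `∃ τ₀ ∀ τ ≥ τ₀` (the sharpening the 14680 lead
and its disprover asked of 14662), so that all channels of the ledger run on ONE common window. Constant families give back
the pointwise statement. -/
def KineticCurrentsWindowLDFamily : Prop :=
  ∃ η₀ : ℝ, 0 < η₀ ∧ ∀ (t₁ : ℝ) (a θ₀ : ℝ → T3 → ℝ) (u₀ : ℝ → T3 → V3),
    Continuous (Function.uncurry a) → Continuous (Function.uncurry θ₀) → Continuous (Function.uncurry u₀) →
    (∀ s x, 0 < a s x) → (∀ s x, 0 < θ₀ s x) →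
    ∀ σ : ℝ, 0 < σ → (∀ s ∈ Set.Icc 0 t₁, σ ^ 3 * (⨆ x, a s x) ≤ η₀ * ∫ x, a s x) →
    ∀ Φ : (N : ℕ) → HardSphereFlow (Torus.geometry (Fin 3)) (hsDiameter σ N) (N + 1),
    ∀ (A : ℝ → T3 → Fin 3 → Fin 3 → ℝ) (b : ℝ → T3 → V3) (G : ℝ → T3 × ℝ → ℝ),
    Continuous (Function.uncurry A) → Continuous (Function.uncurry b) → Continuous (Function.uncurry G) →
    (let F := fun (s : ℝ) (y : T3 × V3) =>
       (∑ j : Fin 3, ∑ k : Fin 3, A s y.1 j k * ((y.2 - u₀ s y.1) j * (y.2 - u₀ s y.1) k)) +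
         (∑ j : Fin 3, b s y.1 j * (y.2 - u₀ s y.1) j) * G s (y.1, ‖y.2 - u₀ s y.1‖ ^ 2)
     (∃ C : ℝ, ∀ s ∈ Set.Icc 0 t₁, ∀ y : T3 × V3, |F s y| ≤ C * (1 + ‖y.2‖ ^ 2)) →
     (∀ s ∈ Set.Icc 0 t₁, ∀ x, ∫ v, F s (x, v) * localMaxwellian 1 (θ₀ s x) (u₀ s x) v = 0) →
     (∀ s ∈ Set.Icc 0 t₁, ∀ x (j : Fin 3),
        ∫ v, F s (x, v) * v j * localMaxwellian 1 (θ₀ s x) (u₀ s x) v = 0) →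
     (∀ s ∈ Set.Icc 0 t₁, ∀ x, ∫ v, F s (x, v) * ‖v‖ ^ 2 * localMaxwellian 1 (θ₀ s x) (u₀ s x) v = 0) →
     ∃ β₀ : ℝ, 0 < β₀ ∧ ∀ β : ℝ, |β| ≤ β₀ → ∀ ε : ℝ, 0 < ε → ∃ τ₀ : ℝ, 0 < τ₀ ∧ ∀ τ : ℝ, τ₀ ≤ τ →
     ∃ N₀ : ℕ, ∀ N : ℕ, N₀ ≤ N → ∀ s ∈ Set.Icc 0 t₁,
       ∫⁻ z, ENNReal.ofReal (Real.exp (β * ∑ i : Fin (N + 1),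
           (τ * ((N : ℝ) + 1) ^ (-(1 / 3 : ℝ)))⁻¹ *
             ∫ r in (0 : ℝ)..(τ * ((N : ℝ) + 1) ^ (-(1 / 3 : ℝ))), F s ((Φ N).flow r z i)))
         ∂(localGibbsLaw σ (a s) (u₀ s) (θ₀ s) N (Φ N)) ≤
       ENNReal.ofReal (Real.exp (ε * ((N : ℝ) + 1))))

/-- **The ENERGY-activity twin of `CollisionActivityTails`** (prices the energy part of the transfer clamp) — byte-identical with
the sibling's `CoherenceNotTails.CollisionEnergyActivityTails`. -/
def CollisionEnergyActivityTails : Prop :=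
  ∀ (a₀ θ₀ : T3 → ℝ) (u₀ : T3 → V3), Continuous a₀ → Continuous θ₀ → Continuous u₀ → (∀ x, 0 < a₀ x) →
    (∀ x, 0 < θ₀ x) → ∃ σ₀ : ℝ, 0 < σ₀ ∧ ∀ σ : ℝ, 0 < σ → σ < σ₀ →
    ∀ (T : ℝ) (ρ θ : ℝ → T3 → ℝ) (u : ℝ → T3 → V3), IsHardSphereEulerSolution σ T ρ u θ →
    ∀ Φ : (N : ℕ) → HardSphereFlow (Torus.geometry (Fin 3)) (hsDiameter σ N) (N + 1),
    TendstoHydroFieldsAt (fun N => localGibbsLaw σ a₀ u₀ θ₀ N (Φ N)) Φ ρ u θ 0 →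
    ∀ t ∈ Set.Ico 0 T, ∃ V₀ : ℝ, 0 < V₀ ∧ ∀ V : ℝ, V₀ ≤ V → ∀ ε : ℝ, 0 < ε → ∃ τ₀ : ℝ, 0 < τ₀ ∧
    ∀ τ : ℝ, τ₀ ≤ τ → ∃ N₀ : ℕ, ∀ N : ℕ, N₀ ≤ N → ∀ s ∈ Set.Icc 0 t,
      (let w : ℝ := τ * ((N : ℝ) + 1) ^ (-(1 / 3 : ℝ))
       let P := localGibbsLaw σ a₀ u₀ θ₀ N (Φ N)
       let act := fun (i : Fin (N + 1)) (z : Config (N + 1) (Fin 3) T3) =>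
         σ / τ * (Φ N).collisionSum (Set.Ioc s (s + w))
           (fun c => if c.fst = i then |‖c.postVel.1‖ ^ 2 - ‖c.preVel.1‖ ^ 2| / 2 else 0) z
       ∫⁻ z, ENNReal.ofReal (((N : ℝ) + 1)⁻¹ * ∑ i : Fin (N + 1),
           Set.indicator {y : ℝ | V < y} (fun y => y) (act i z)) ∂P ≤ ENNReal.ofReal ε)

/-- **The sibling line's true-law bet, RADIALLY WEIGHTED form = `CoherentSuprathermalContentVanishesW`** (v9; verbatim the
sibling crux 14680's S6′ after its finding CUTOFF-MATCHING: coherence is tested against a bounded measurable RADIAL WEIGHT `R`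
vanishing below `K⋆²`, so that the ledger can feed KCWU-along-families the CONTINUOUS re-orthogonalised cut-off and test coherence with
the actual remainder profile; the sharp v8 form forced a discontinuous thermal cut-off into the kinetic class). Frame of ECT. -/
def CoherentSuprathermalContentVanishesW : Prop :=
  ∀ (a₀ θ₀ : T3 → ℝ) (u₀ : T3 → V3), Continuous a₀ → Continuous θ₀ → Continuous u₀ →
    (∀ x, 0 < a₀ x) → (∀ x, 0 < θ₀ x) →
    ∃ σ₀ : ℝ, 0 < σ₀ ∧ ∀ σ : ℝ, 0 < σ → σ < σ₀ →
    ∀ (T : ℝ) (ρ θ : ℝ → T3 → ℝ) (u : ℝ → T3 → V3), IsHardSphereEulerSolution σ T ρ u θ →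
    ∀ Φ : (N : ℕ) → HardSphereFlow (Torus.geometry (Fin 3)) (hsDiameter σ N) (N + 1),
    TendstoHydroFieldsAt (fun N => localGibbsLaw σ a₀ u₀ θ₀ N (Φ N)) Φ ρ u θ 0 →
    ∀ t ∈ Set.Ico 0 T, ∃ Kstar : ℝ, 0 < Kstar ∧
    ∀ R : ℝ → T3 → ℝ → ℝ, Measurable (fun p : ℝ × T3 × ℝ => R p.1 p.2.1 p.2.2) →
    (∀ s x s', s' ≤ Kstar ^ 2 → R s x s' = 0) → (∀ s x s', |R s x s'| ≤ |s'|) →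
    ∀ η : ℝ, 0 < η → ∀ ε : ℝ, 0 < ε →
    ∃ τ₀ : ℝ, 0 < τ₀ ∧ ∀ τ : ℝ, τ₀ ≤ τ → ∃ N₀ : ℕ, ∀ N : ℕ, N₀ ≤ N → ∀ s ∈ Set.Icc 0 t,
      (let w : ℝ := τ * ((N : ℝ) + 1) ^ (-(1 / 3 : ℝ))
       let P := localGibbsLaw σ a₀ u₀ θ₀ N (Φ N)
       let W := fun (i : Fin (N + 1)) (s r : ℝ) (z : Config (N + 1) (Fin 3) T3) =>
         ((Φ N).flow r z i).2 - u s ((Φ N).flow r z i).1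
       let cub := fun (i : Fin (N + 1)) (s : ℝ) (z : Config (N + 1) (Fin 3) T3) =>
         w⁻¹ * ∫ r in s..(s + w), ‖W i s r z‖ ^ 3
       let cubHi := fun (i : Fin (N + 1)) (s : ℝ) (z : Config (N + 1) (Fin 3) T3) =>
         w⁻¹ * ∫ r in s..(s + w), (if Kstar < ‖W i s r z‖ then ‖W i s r z‖ ^ 3 else 0)
       let qbar := fun (i : Fin (N + 1)) (s : ℝ) (z : Config (N + 1) (Fin 3) T3) =>
         w⁻¹ • ∫ r in s..(s + w), (R s ((Φ N).flow r z i).1 (‖W i s r z‖ ^ 2)) • W i s r z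
       ∫⁻ z, ENNReal.ofReal (((N : ℝ) + 1)⁻¹ * ∑ i : Fin (N + 1),
              (if η * cub i s z < ‖qbar i s z‖ then cubHi i s z else 0)) ∂P ≤ ENNReal.ofReal ε)

/-- **The LOCAL clamped collisional-transfer window LD ALONG FAMILIES = `LocalClampedTransferWindowLDFamily`** (v8; the
family-uniform typing of the sibling's `CoherenceNotTails.LocalClampedTransferWindowLD`, whose counter-term coefficients passed
the first-order statics audit of cycle 2). Same `η₀`-uniform packing guard, same transfer-activity clamp, same momentum / energy
rows with the local EOS projection (x-dependent coefficients through `ρ₀ = rhoLim (profileOf a_s)`, `Z`, `Z′`) and the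
deterministic centring, same scale-`N` exponential-moment bound — but for one-parameter FAMILIES `s ↦ (a_s, θ_s, u_s; φ_s)`
(profiles jointly continuous, test function jointly smooth on `[0,t₁] × 𝕋³`), hypotheses for every `s ∈ [0,t₁]`, thresholds
`V₀, β₀, τ₀, N₀` uniform: `∀ s ∈ [0,t₁]` INNERMOST. Constant families give back the pointwise statement. -/
def LocalClampedTransferWindowLDFamily : Prop :=
  ∃ η₀ : ℝ, 0 < η₀ ∧ ∀ (t₁ : ℝ) (a θ₀ : ℝ → T3 → ℝ) (u₀ : ℝ → T3 → V3) (ha : ∀ s, Continuous (a s)),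
    Continuous (Function.uncurry a) → Continuous (Function.uncurry θ₀) → Continuous (Function.uncurry u₀) →
    ∀ (ha0 : ∀ s x, 0 < a s x), (∀ s x, 0 < θ₀ s x) → ∀ σ : ℝ, 0 < σ → σ < 1 / 2 →
    (∀ s ∈ Set.Icc 0 t₁, σ ^ 3 * (⨆ x, a s x) ≤ η₀ * ∫ x, a s x) →
    ∀ Φ : (N : ℕ) → HardSphereFlow (Torus.geometry (Fin 3)) (hsDiameter σ N) (N + 1),
    ∀ φ : ℝ → T3 → ℝ, Torus.IsSmoothSpaceTimeOn (Set.Icc 0 t₁) φ →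
    ∃ V₀ : ℝ, 0 < V₀ ∧ ∀ V : ℝ, V₀ ≤ V → ∃ β₀ : ℝ, 0 < β₀ ∧ ∀ β : ℝ, |β| ≤ β₀ → ∀ ε : ℝ, 0 < ε →
    ∃ τ₀ : ℝ, 0 < τ₀ ∧ ∀ τ : ℝ, τ₀ ≤ τ → ∃ N₀ : ℕ, ∀ N : ℕ, N₀ ≤ N → ∀ s ∈ Set.Icc 0 t₁,
      (let ρ₀ : T3 → ℝ := rhoLim (profileOf (a s) (ha s) (ha0 s)) σ
       let w : ℝ := τ * ((N : ℝ) + 1) ^ (-(1 / 3 : ℝ))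
       let P := localGibbsLaw σ (a s) (u₀ s) (θ₀ s) N (Φ N)
       let Z : T3 → ℝ := fun x => hsCompressibility (ρ₀ x * σ ^ 3)
       let Z' : T3 → ℝ := fun x => deriv hsCompressibility (ρ₀ x * σ ^ 3)
       let act := fun (i : Fin (N + 1)) (z : Config (N + 1) (Fin 3) T3) =>
         σ / τ * (Φ N).collisionSum (Set.Ioc 0 w) (fun c => if c.fst = i then
           ‖c.postVel.1 - c.preVel.1‖ + |‖c.postVel.1‖ ^ 2 - ‖c.preVel.1‖ ^ 2| / 2 else 0) z
       let ω := fun (i : Fin (N + 1)) (z : Config (N + 1) (Fin 3) T3) => if act i z ≤ V then (1 : ℝ) else 0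
       let Xm := fun (k : Fin 3) (z : Config (N + 1) (Fin 3) T3) =>
         (Φ N).collisionSum (Set.Ioc 0 w)
           (fun c => ω c.fst z * ω c.snd z * ((φ s c.fstPos - φ s c.sndPos) * (c.postVel.1 k - c.preVel.1 k)) / 2) z
       let Am := fun (k : Fin 3) (z : Config (N + 1) (Fin 3) T3) =>
         (∫ r in (0 : ℝ)..w, ∑ i : Fin (N + 1), Torus.partialDeriv k (φ s) ((Φ N).flow r z i).1 *
           (θ₀ s ((Φ N).flow r z i).1 * (ρ₀ ((Φ N).flow r z i).1 * σ ^ 3) * Z' ((Φ N).flow r z i).1 +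
             (1 / 3) * (Z ((Φ N).flow r z i).1 - 1) * ‖((Φ N).flow r z i).2 - u₀ s ((Φ N).flow r z i).1‖ ^ 2)) -
         w * ((N : ℝ) + 1) * ∫ x, ρ₀ x * Torus.partialDeriv k (φ s) x * (θ₀ s x * (ρ₀ x * σ ^ 3) * Z' x)
       let Xe := fun (z : Config (N + 1) (Fin 3) T3) =>
         (Φ N).collisionSum (Set.Ioc 0 w)
           (fun c => ω c.fst z * ω c.snd z *
             ((φ s c.fstPos - φ s c.sndPos) * ((‖c.postVel.1‖ ^ 2 - ‖c.preVel.1‖ ^ 2) / 2)) / 2) z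
       let Ae := fun (z : Config (N + 1) (Fin 3) T3) =>
         (∫ r in (0 : ℝ)..w, ∑ i : Fin (N + 1),
           ((∑ l : Fin 3, u₀ s ((Φ N).flow r z i).1 l * Torus.partialDeriv l (φ s) ((Φ N).flow r z i).1) *
               (θ₀ s ((Φ N).flow r z i).1 * (ρ₀ ((Φ N).flow r z i).1 * σ ^ 3) * Z' ((Φ N).flow r z i).1 +
                 (1 / 3) * (Z ((Φ N).flow r z i).1 - 1) * ‖((Φ N).flow r z i).2 - u₀ s ((Φ N).flow r z i).1‖ ^ 2) +
             θ₀ s ((Φ N).flow r z i).1 * (Z ((Φ N).flow r z i).1 - 1) *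
               (∑ l : Fin 3, Torus.partialDeriv l (φ s) ((Φ N).flow r z i).1 *
                 (((Φ N).flow r z i).2 - u₀ s ((Φ N).flow r z i).1) l))) -
         w * ((N : ℝ) + 1) *
           ∫ x, ρ₀ x * (∑ l : Fin 3, u₀ s x l * Torus.partialDeriv l (φ s) x) * (θ₀ s x * (ρ₀ x * σ ^ 3) * Z' x)
       (∀ k : Fin 3, ∫⁻ z, ENNReal.ofReal (Real.exp (β * (w⁻¹ * Xm k z - w⁻¹ * Am k z))) ∂P ≤
           ENNReal.ofReal (Real.exp (ε * ((N : ℝ) + 1)))) ∧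
         ∫⁻ z, ENNReal.ofReal (Real.exp (β * (w⁻¹ * Xe z - w⁻¹ * Ae z))) ∂P ≤
           ENNReal.ofReal (Real.exp (ε * ((N : ℝ) + 1))))

/-- **The INPUTS of the ledger, bundled (v9)**: the LOCAL family-uniform collisional LD, the energy-activity tails, the
weighted coherent-suprathermal bet, KCWU along families, and the board items CAT (13734), ECT (9235) by name. None is attacked
by this line; the two family-uniform typings and CSCV-W are new statements (planner: file them; 14662 as typed is not consumable
by any clock along a time-dependent reference — `UNIFORMITY-9133-c2.md`; the sibling's `LineInputs` is the same list minus the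
board items). -/
def LineInputs : Prop :=
  LocalClampedTransferWindowLDFamily ∧ CollisionEnergyActivityTails ∧ CoherentSuprathermalContentVanishesW ∧
    KineticCurrentsWindowLDFamily ∧ OneFlightGossipEngine.CollisionActivityTails ∧
    OneFlightGossipEngine.EnergyCurrentTails

/-! ## §3 The shared heart and the window continuity, as propositions -/

/-- **THE HEART as ONE implication shared by both cruxes = `OneWindowLedger`** (v9; verbatim the sibling crux 14680's registered
`stub_oneWindowLedger` signature, with the four LANDED pathwise/pointwise pieces S2 `PathwiseEntropyProduction` (p98761), S8
`EulerCancellation` (p101112), S4 `EosConsistency` (p97592), S10 `TransferClampRemainder` (p100385) as leading hypotheses, referenced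
here through their Theorems copies): the family-uniform local clamped collisional LD, the energy-activity tails, the weighted coherence
input, KCWU along families, CAT and ECT imply `OneWindowLedgerStatic`. ONE landed proof closes this stub in both skeletons. -/
def OneWindowLedger : Prop :=
  PathwiseEntropyProduction → EulerCancellation → EosConsistency → TransferClampRemainder →
    LocalClampedTransferWindowLDFamily → CollisionEnergyActivityTails →
    CoherentSuprathermalContentVanishesW → KineticCurrentsWindowLDFamily → OneFlightGossipEngine.CollisionActivityTails →
    OneFlightGossipEngine.EnergyCurrentTails → OneWindowLedgerStatic

/-- **Window continuity from the true-law inputs** (the registered `stub_windowContinuityInBand` of stmt-9133 / `stub_windowContinuity`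
of stmt-14680, same signature; LANDED p118327). -/
def WindowContinuity : Prop :=
  OneFlightGossipEngine.CollisionActivityTails → CollisionEnergyActivityTails →
    OneFlightGossipEngine.EnergyCurrentTails → WindowContinuityInBand

/-! ## §4 The glue (sorry-free) -/

/-- **The integrated ledger in band + the a-priori bound ⇒ the guarded Grönwall core.** With the analytic insertion factor of
`stub_eosRatioAnalytic` and the matrix of `uniformLocalGibbsConcentration_proof`: `η_c := min ηp (r/6)`,
`σ₀ := min σ_L (min σ_z (1/2))`. For the handed-over activity at time `t`, the landed G3
(`EntropyClockDock.referenceIdentificationInBand`) replaces its law by the explicit reference (`6σ³ sup ρ_t < r` from the guard);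
`H_N(0) = 0` by `QuenchedCellClock.stub_timeZeroReference` + `klDiv_lawAt_zero_localGibbsLaw`; the running-supremum Grönwall
`ClampedCurrentsDockLedgerGlue.le_mul_exp_of_integral_sSup` (landed for the sibling) gives `H_N(t) ≤ (N+1)ε e^{Kt}`; `ℝ≥0∞`
bookkeeping. [cite: Yau1991, §2] -/
theorem gronwallCoreInBand_of_ledger (hA : LedgerAprioriBound) (hL : LedgerIntegratedCoreInBand) : GronwallCoreInBand := by
  obtain ⟨r, hr, Rf, hana, -, -, hsol, hbd, hLip, huniq⟩ := Theorems.stub_eosRatioAnalytic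
  have hcont : ContinuousOn Rf (Set.Icc 0 r) := by
    obtain ⟨L, hL⟩ := hLip
    exact hL.continuousOn
  obtain ⟨ηU, hηU, HU⟩ := Theorems.uniformLocalGibbsConcentration_proof
  obtain ⟨ηp, hηp, HL⟩ := hL r Rf hr hana hLip hsol hbd hcont huniq ηU hηU HU
  refine ⟨min ηp (r / 6), lt_min hηp (by positivity), fun a₀ θ₀ u₀ ha hθ hu ha0 hθ0 => ?_⟩
  obtain ⟨σL, hσL, HσL⟩ := HL a₀ θ₀ u₀ ha hθ hu ha0 hθ0
  obtain ⟨σz, hσz, Hz⟩ :=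
    Theorems.QuenchedCellClock.stub_timeZeroReference hr hsol hbd hcont huniq a₀ θ₀ u₀ ha hθ hu ha0 hθ0
  refine ⟨min σL (min σz (1 / 2)), lt_min hσL (lt_min hσz (by norm_num)), ?_⟩
  intro σ hσ hσlt T ρ θ u hE hguard Φ htie t ht a hac hap hale hQs hlim
  have hσL' : σ < σL := hσlt.trans_le (min_le_left _ _)
  have hσz' : σ < σz := hσlt.trans_le ((min_le_right _ _).trans (min_le_left _ _))
  have hσ2' : σ < 1 / 2 := hσlt.trans_le ((min_le_right _ _).trans (min_le_right _ _))
  have hσ2 : σ ≤ 1 / 2 := hσ2'.le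
  have hT : 0 < T := ht.1.trans ht.2
  have htI : t ∈ Set.Ico 0 T := ⟨ht.1.le, ht.2⟩
  -- the Euler slice at time `t`
  have hρtc : Continuous (ρ t) := (hE.smooth_density.isSmooth_slice htI).continuous
  have hρtpos : ∀ x, 0 < ρ t x := hE.density_pos t htI
  -- packing from THE GUARD: `< ηp` on `[0,T)`, `< r` on `[0,t]`, and `6 σ³ sup ρ_t < r`
  have hpackp : ∀ s ∈ Set.Ico 0 T, ∀ x, ρ s x * σ ^ 3 < ηp := fun s hs x =>
    (hguard s hs x).trans_le (min_le_left _ _)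
  have hpackr : ∀ s ∈ Set.Icc 0 t, ∀ x, ρ s x * σ ^ 3 < r := fun s hs x =>
    ((hguard s ⟨hs.1, hs.2.trans_lt ht.2⟩ x).trans_le (min_le_right _ _)).trans_le (by linarith)
  have h6 : 6 * (σ ^ 3 * ⨆ x, ρ t x) < r := by
    have hbdd : BddAbove (Set.range (ρ t)) := (isCompact_range hρtc).bddAbove
    obtain ⟨xM, -, hxM⟩ := isCompact_univ.exists_isMaxOn Set.univ_nonempty hρtc.continuousOn
    have hsup : (⨆ x, ρ t x) = ρ t xM :=
      le_antisymm (ciSup_le fun x => (isMaxOn_iff.mp hxM) x (Set.mem_univ x)) (le_ciSup hbdd xM)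
    have h1 : ρ t xM * σ ^ 3 < r / 6 := (hguard t htI xM).trans_le (min_le_right _ _)
    rw [hsup, mul_comm (σ ^ 3)]
    linarith
  -- G3 (landed): the handed-over reference IS the explicit one
  have hlaw : ∀ N : ℕ, localGibbsLaw σ a (u t) (θ t) N (Φ N) =
      localGibbsLaw σ (fun x => ρ t x * Rf (σ ^ 3 * ρ t x)) (u t) (θ t) N (Φ N) := fun N =>
    (Theorems.EntropyClockDock.referenceIdentificationInBand r Rf hr huniq σ hσ (ρ t) a hac hap hρtc hρtpos hale
      hQs hlim h6 (u t) (θ t) N (Φ N)).symm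
  simp only [hlaw]
  -- the ledger in band and the a-priori bound, along the explicit reference family
  obtain ⟨K, hK, hstep⟩ := HσL σ hσ hσL' T ρ θ u hE hpackp Φ htie t ht
  have hB : ∀ N : ℕ, ∃ B : ℝ, ∀ s ∈ Set.Icc 0 t,
      klDiv ((Φ N).lawAt (localGibbsLaw σ a₀ u₀ θ₀ N (Φ N)) s)
        (localGibbsLaw σ (fun x => ρ s x * Rf (σ ^ 3 * ρ s x)) (u s) (θ s) N (Φ N)) ≤ ENNReal.ofReal B :=
    fun N => hA r Rf hr hbd hcont a₀ θ₀ u₀ ha hθ hu ha0 hθ0 σ hσ hσ2' T ρ θ u hE t ht hpackr N (Φ N)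
  have hlaw0 := Hz σ hσ hσz' T ρ θ u hE hT Φ htie
  -- adapted from `ClampedCurrentsDockLedgerGlue.stub_ledgerGronwall` (the sibling's ledger end, landed)
  set H : ℕ → ℝ → ℝ := fun N s =>
    (klDiv ((Φ N).lawAt (localGibbsLaw σ a₀ u₀ θ₀ N (Φ N)) s)
      (localGibbsLaw σ (fun x => ρ s x * Rf (σ ^ 3 * ρ s x)) (u s) (θ s) N (Φ N))).toReal with hH
  have hHnn : ∀ N s, 0 ≤ H N s := fun N s => ENNReal.toReal_nonneg
  have hH0 : ∀ N, H N 0 = 0 := by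
    intro N
    simp only [hH, hlaw0 N, Theorems.EntropyClockDock.klDiv_lawAt_zero_localGibbsLaw hσ2 ha hθ hu ha0 hθ0 N (Φ N),
      ENNReal.toReal_zero]
  have hreal : Tendsto (fun N : ℕ => H N t / ((N : ℝ) + 1)) atTop (𝓝 0) := by
    rw [Metric.tendsto_atTop]
    intro δ hδ
    set ε : ℝ := δ / (2 * Real.exp (K * t)) with hε
    have hεpos : 0 < ε := by positivity
    obtain ⟨N₀, hN₀⟩ := hstep ε hεpos
    refine ⟨N₀, fun N hN => ?_⟩
    have hNpos : (0 : ℝ) < (N : ℝ) + 1 := by positivity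
    obtain ⟨B, hBN⟩ := hB N
    have hHB : ∀ s ∈ Set.Icc 0 t, H N s ≤ max B 0 := by
      intro s hs
      exact ENNReal.toReal_le_of_le_ofReal (le_max_right _ _)
        ((hBN s hs).trans (ENNReal.ofReal_le_ofReal (le_max_left _ _)))
    have hmain : H N t ≤ ((N : ℝ) + 1) * ε * Real.exp (K * t) :=
      Theorems.ClampedCurrentsDockLedgerGlue.le_mul_exp_of_integral_sSup (H := H N) ht.1.le hK hHB (hH0 N)
        (fun t' ht' => hN₀ N hN t' ht')
    have hval : ((N : ℝ) + 1) * ε * Real.exp (K * t) = ((N : ℝ) + 1) * (δ / 2) := by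
      have hexp : Real.exp (K * t) ≠ 0 := (Real.exp_pos _).ne'
      rw [hε]
      field_simp
    have hq : H N t / ((N : ℝ) + 1) ≤ δ / 2 := by
      rw [div_le_iff₀ hNpos]
      calc H N t ≤ ((N : ℝ) + 1) * ε * Real.exp (K * t) := hmain
        _ = ((N : ℝ) + 1) * (δ / 2) := hval
        _ = δ / 2 * ((N : ℝ) + 1) := by ring
    have hq0 : 0 ≤ H N t / ((N : ℝ) + 1) := div_nonneg (hHnn N t) hNpos.le
    rw [Real.dist_eq, sub_zero, abs_of_nonneg hq0]
    linarith
  -- back to `ℝ≥0∞`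
  have hfin : ∀ N : ℕ, klDiv ((Φ N).lawAt (localGibbsLaw σ a₀ u₀ θ₀ N (Φ N)) t)
      (localGibbsLaw σ (fun x => ρ t x * Rf (σ ^ 3 * ρ t x)) (u t) (θ t) N (Φ N)) ≠ ⊤ := by
    intro N
    obtain ⟨B, hBN⟩ := hB N
    exact ne_top_of_le_ne_top ENNReal.ofReal_ne_top (hBN t ⟨ht.1.le, le_rfl⟩)
  have hcongr : ∀ N : ℕ, klDiv ((Φ N).lawAt (localGibbsLaw σ a₀ u₀ θ₀ N (Φ N)) t)
      (localGibbsLaw σ (fun x => ρ t x * Rf (σ ^ 3 * ρ t x)) (u t) (θ t) N (Φ N)) / ((N : ℝ≥0∞) + 1) =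
      ENNReal.ofReal (H N t / ((N : ℝ) + 1)) := by
    intro N
    have hNpos : (0 : ℝ) < (N : ℝ) + 1 := by positivity
    rw [ENNReal.ofReal_div_of_pos hNpos, hH, ENNReal.ofReal_toReal (hfin N)]
    congr 1
    rw [ENNReal.ofReal_add (by positivity) zero_le_one, ENNReal.ofReal_natCast, ENNReal.ofReal_one]
  simp only [hcongr]
  rw [← ENNReal.ofReal_zero]
  exact ENNReal.tendsto_ofReal hreal

/-- **The guarded Grönwall core from the heart, the continuity and the inputs.** -/
theorem gronwallCoreInBand_of_heart (hW : OneWindowLedger) (hC : WindowContinuity) (hI : LineInputs) : GronwallCoreInBand :=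
  gronwallCoreInBand_of_ledger Theorems.EntropyClockDock.ledgerAprioriBound
    (stub_ledgerFromWindowsS
      (hW Theorems.ClampedCurrentsDockPathwise.stub_pathwise
        Theorems.ClampedCurrentsDockCancellation.stub_cancellation Theorems.ClampedCurrentsDockEos.stub_eos
        Theorems.ClampedCurrentsDockClampRemainder.stub_transferClampRemainder
        hI.1 hI.2.1 hI.2.2.1 hI.2.2.2.1 hI.2.2.2.2.1 hI.2.2.2.2.2)
      (hC hI.2.2.2.2.1 hI.2.1 hI.2.2.2.2.2)
      Theorems.EntropyClockDock.ledgerAprioriBound)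

/-- **`HydroLimitInBand` from the shared heart, the window continuity and the inputs** (registered support `hydroLimitInBand_of_heart`
of stmt-9133): the landed reduction (p97252) and dock (p97115) finish. -/
theorem hydroLimitInBand_of_heart (hW : OneWindowLedger) (hC : WindowContinuity) (hI : LineInputs) :
    ImplosionDichotomy.HydroLimitInBand :=
  Theorems.hydroLimitInBand_of_relEntropyVanishingInBand
    (Theorems.EntropyClockDock.relEntropyVanishingInBand_of_gronwallCoreInBand (gronwallCoreInBand_of_heart hW hC hI))

/- MAINTENANCE 2026-08-17 (lead c7 of stmt-9133). Route LaxScheme DROPPED its byte-identical copy `Theses.LaxScheme.HydroLimitInBand` of the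
shared crux at its rev 5 (2026-08-16T23:34Z; after the D-0032 re-type the crux is the sub-problem Statement itself). The theorem below, typed as
that copy, then stopped elaborating — and with it the post-accept build of EVERY module importing this one (…HydroLimitInBandWindowClause,
OneFlightGossipEngineAssemblyOfHeart, TwoClocksTransferEntropyClockFamilyNodesReduction, the pending split glue). This alias namespace restores
elaboration WITHOUT mutating the append-only statement text: inside this namespace `LaxScheme.HydroLimitInBand` now resolves to the surviving,
definitionally equal `Theses.ImplosionDichotomy.HydroLimitInBand` (an `export` alias is not a declaration). Use `hydroLimitInBand_of_heart`. -/
namespace LaxScheme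
export Summit.AtomisticToContinuum.HydrodynamicLimit.Theses.ImplosionDichotomy (HydroLimitInBand)
end LaxScheme

/-- The same, typed as the LaxScheme route's copy of the (shared) crux decl — identical body. -/
theorem laxScheme_hydroLimitInBand_of_heart (hW : OneWindowLedger) (hC : WindowContinuity) (hI : LineInputs) :
    LaxScheme.HydroLimitInBand :=
  hydroLimitInBand_of_heart hW hC hI

end Summit.AtomisticToContinuum.HydrodynamicLimit.Theorems.HydroLimitInBandOfHeart

end
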